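import Mathlib
import HarnessLib
import Summits.ValiantsHypothesis.ValiantsHypothesis.Theses.MonotoneRestoration
import Summits.ValiantsHypothesis.ValiantsHypothesis.Theorems.MonotoneRestorationOrbitRestorationLinearVolumeQPDiNarrowTight
import Summits.ValiantsHypothesis.ValiantsHypothesis.Theorems.MonotoneRestorationOrbitRestorationLinearVolumeQPDiUnfolding
import Summits.ValiantsHypothesis.ValiantsHypothesis.Theorems.MonotoneRestorationOrbitRestorationLinearVolumeQPDiHomPolyClose
import Summits.ValiantsHypothesis.ValiantsHypothesis.Theorems.MonotoneRestorationOrbitRestorationLinearVolumeQPSubThresholdDescent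
import Summits.ValiantsHypothesis.ValiantsHypothesis.Theorems.MonotoneRestorationOrbitCompressionQPDiHomSpan
import Summits.ValiantsHypothesis.ValiantsHypothesis.Theorems.MonotoneRestorationOrbitRestorationQPSplit

/-!
# Route MonotoneRestoration — aside `OrbitRestorationLinearVolumeQP` (stmt-ValiantsHypothesis-18294):
# THE CRUX IN ONE-SORTED SPAN CURRENCY (tight) — R1 ⟺ `LvDiNarrowSpan`

The registered skeleton of R1 (line `birth`, `0500973389fe`) rests on `stub_lvNarrowSpan : LvNarrowSpan` — every
`VP` family of the linear-volume class lies, level by level, in the `ℂ`-span of the homomorphism polynomials of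
BIPARTITE patterns of treewidth `≤ (log₂ n + c)^c` — a SUFFICIENT, VH-strength statement whose necessity is the open
descent question above the injective threshold.  This file gives the crux an EQUIVALENT statement OF THE SAME SHAPE,
with one-sorted (directed looped) patterns in place of bipartite ones:

  `LvDiNarrowSpan`:  every `VP ∩ LV` family `f` lies, for one constant `c` and EVERY level `n`, in
  `span_ℂ {dihom_{D,n} : D : Multiset (Fin a × Fin a), tw D ≤ (log₂ n + c)^c}`.

* `diNarrowSpan_of_diNarrow` — family by family: a square-symmetric family that is eventually the closed
  polynomial of one-sorted expressions with `n^k ≤ 2^{(log₂ n + c)^c}` labels lies on EVERY level in the one-sorted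
  narrow span (unfolding `DiUnfolding.close_mem_diNarrowSpan`; small levels by the square-symmetric degree floor
  `DiHomSpan.mem_span_diHom_of_squareSymmetric`);
* `lvDiNarrowSpan_of_orbitRestorationLinearVolumeQP` — **R1 ⟹ `LvDiNarrowSpan`**;
* `orbitRestorationLinearVolumeQP_of_lvDiNarrowSpan` — **`LvDiNarrowSpan` ⟹ R1** (one-sorted K2
  `DiHomPolyClose.diNarrowExpression_of_mem_diNarrowSpan`: the span at width `w` is ONE closed expression with
  `w + 1` labels, `n^{w+1} ≤ 2^{(log₂ n + c + 3)^{c+3}}`; then `orbitRestorationLinearVolumeQP_of_lvDiNarrow`);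
* `orbitRestorationLinearVolumeQP_iff_lvDiNarrowSpan` — **R1 ⟺ `LvDiNarrowSpan`** (TIGHT: a skeleton with this
  single stub closes the crux with no loss, in the registered stub's own currency);
* `lvDiNarrowSpan_of_lvNarrowSpanConclusion` (the registered stub implies it, orientation) and
  `narrowSpan_halfDegree_of_diNarrowSpan` (it implies the registered stub's conclusion on every level with
  `2 · deg f_n ≤ n`, sub-threshold descent p827466).

Honest label: currency bookkeeping built on this hand's unfolding + one-sorted K2 (VH-free); the stub
`stub_lvNarrowSpan`, R1 and VP ≠ VNP are NOT moved; R1 (hence `LvDiNarrowSpan`) remains VH-strength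
(`OrbitRestorationLinearVolumeQPVHStrength.valiantsHypothesis_of_orbitRestorationLinearVolumeQP`).  Def-free helper
(`--supports stmt-ValiantsHypothesis-18294`); nothing here is a named fact.

References: Dwivedi–Pago–Seppelt 2026 (arXiv:2601.09343) eq. (1), Outlook Q3; Dawar–Pago–Seppelt 2025
(arXiv:2502.06740) Thm 1.1, §5, Remark p. 17, §7 p. 45; Dawar–Wilsenach 2025 §6.
-/

noncomputable section

open scoped Classical

-- `Summit.ValiantsHypothesis.ValiantsHypothesis.…` is the tree's single-conjunct layout (Sub = Summit).
set_option linter.dupNamespace false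

namespace Summit.ValiantsHypothesis.ValiantsHypothesis.Theorems.OrbitRestorationLinearVolumeQPDiNarrowSpan

open Literature.Computability.AlgebraicComplexity MvPolynomial
open Literature.Combinatorics.SimpleGraph (treewidth treewidth_le_card_sub_one)
open Summit.ValiantsHypothesis.ValiantsHypothesis.Theorems

/-! ### The square-symmetric degree floor in treewidth currency -/

/-- **Degree floor (one-sorted).**  A square-symmetric polynomial of degree `d` lies in the span of the
one-sorted homomorphism polynomials of patterns of treewidth `≤ 2d` (patterns on `≤ 2d` vertices,
`DiHomSpan.mem_span_diHom_of_squareSymmetric`, and `tw ≤ #V - 1`). [folklore] -/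
theorem mem_diNarrowSpan_twice_degree {n : ℕ} (p : MvPolynomial (Fin n × Fin n) ℂ)
    (hp : ∀ σ : Equiv.Perm (Fin n), rename (fun ij : Fin n × Fin n => (σ ij.1, σ ij.2)) p = p) :
    p ∈ Submodule.span ℂ {q : MvPolynomial (Fin n × Fin n) ℂ |
      ∃ (a : ℕ) (D : Multiset (Fin a × Fin a)),
        treewidth (SimpleGraph.fromRel fun u v : Fin a => ∃ e ∈ D, u = e.1 ∧ v = e.2) ≤
            2 * p.totalDegree ∧ q = diHomPoly D n ℂ} := by
  refine Submodule.span_mono (fun q hq => ?_) (DiHomSpan.mem_span_diHom_of_squareSymmetric p hp)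
  obtain ⟨a, D, ha, -, -, -, rfl⟩ := hq
  refine ⟨a, D, (treewidth_le_card_sub_one _).trans ?_, rfl⟩
  rw [Fintype.card_fin]
  omega

/-! ### One-sorted narrow expressions ⟹ one-sorted narrow span, on every level -/

/-- **Eventually-narrow one-sorted expressions ⟹ one-sorted narrow span on every level.**  If a
square-symmetric family `f` is, from level `n₀` on, the closed polynomial of a one-sorted labelled pattern
expression with `k` labels, `n^k ≤ 2^{(log₂ n + c)^c}`, then for one constant `c'` and EVERY `n`, `f n` lies in
the span of the one-sorted homomorphism polynomials of patterns of treewidth `≤ (log₂ n + c')^{c'}` (levels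
`≥ max n₀ 2`: `k ≤ (log₂ n + c)^c` and `DiUnfolding.close_mem_diNarrowSpan`; the finitely many small levels by
the degree floor, absorbed in `c'`). [folklore] -/
theorem diNarrowSpan_of_diNarrow (f : (n : ℕ) → MvPolynomial (Fin n × Fin n) ℂ)
    (hsymm : ∀ (n : ℕ) (σ : Equiv.Perm (Fin n)), rename (fun ij : Fin n × Fin n => (σ ij.1, σ ij.2)) (f n) = f n)
    (h : ∃ c n₀ : ℕ, ∀ n : ℕ, n₀ ≤ n → ∃ (k : ℕ) (e : DiPatternExpr ℂ k),
      n ^ k ≤ 2 ^ ((Nat.log 2 n + c) ^ c) ∧ e.close n = f n) :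
    ∃ c : ℕ, ∀ n : ℕ, f n ∈ Submodule.span ℂ {q : MvPolynomial (Fin n × Fin n) ℂ |
      ∃ (a : ℕ) (D : Multiset (Fin a × Fin a)),
        treewidth (SimpleGraph.fromRel fun u v : Fin a => ∃ e ∈ D, u = e.1 ∧ v = e.2) ≤ (Nat.log 2 n + c) ^ c ∧
          q = diHomPoly D n ℂ} := by
  obtain ⟨c, n₀, hc⟩ := h
  -- the bound absorbing the small levels
  set B : ℕ := ∑ m ∈ Finset.range (max n₀ 2), 2 * (f m).totalDegree with hB
  refine ⟨c + max n₀ 2 + B + 1, fun n => ?_⟩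
  have mono : ∀ w w' : ℕ, w ≤ w' →
      Submodule.span ℂ {q : MvPolynomial (Fin n × Fin n) ℂ | ∃ (a : ℕ) (D : Multiset (Fin a × Fin a)),
        treewidth (SimpleGraph.fromRel fun u v : Fin a => ∃ e ∈ D, u = e.1 ∧ v = e.2) ≤ w ∧
          q = diHomPoly D n ℂ} ≤
      Submodule.span ℂ {q : MvPolynomial (Fin n × Fin n) ℂ | ∃ (a : ℕ) (D : Multiset (Fin a × Fin a)),
        treewidth (SimpleGraph.fromRel fun u v : Fin a => ∃ e ∈ D, u = e.1 ∧ v = e.2) ≤ w' ∧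
          q = diHomPoly D n ℂ} := by
    intro w w' hww'
    refine Submodule.span_mono ?_
    rintro q ⟨a, D, hD, rfl⟩
    exact ⟨a, D, hD.trans hww', rfl⟩
  have hwidth : c + max n₀ 2 + B + 1 ≤
      (Nat.log 2 n + (c + max n₀ 2 + B + 1)) ^ (c + max n₀ 2 + B + 1) :=
    le_trans (Nat.le_add_left _ _) (Nat.le_self_pow (by omega) _)
  by_cases hn : max n₀ 2 ≤ n
  · -- large levels: unfold the one-sorted expression
    obtain ⟨k, e, hk, he⟩ := hc n (le_trans (le_max_left _ _) hn)
    have hn2 : 2 ≤ n := le_trans (le_max_right _ _) hn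
    have hkL : k ≤ (Nat.log 2 n + c) ^ c := by
      have h2 : 2 ^ k ≤ 2 ^ ((Nat.log 2 n + c) ^ c) := le_trans (Nat.pow_le_pow_left hn2 k) hk
      exact (Nat.pow_le_pow_iff_right Nat.one_lt_two).1 h2
    have hLL : (Nat.log 2 n + c) ^ c ≤
        (Nat.log 2 n + (c + max n₀ 2 + B + 1)) ^ (c + max n₀ 2 + B + 1) :=
      le_trans (Nat.pow_le_pow_left (by omega) c) (Nat.pow_le_pow_right (by omega) (by omega))
    have hmem := DiUnfolding.close_mem_diNarrowSpan k n
      ((Nat.log 2 n + (c + max n₀ 2 + B + 1)) ^ (c + max n₀ 2 + B + 1)) (by omega) e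
    rwa [he] at hmem
  · -- small levels: the degree floor, width `2 · deg f_n ≤ B`
    have hdeg : 2 * (f n).totalDegree ≤ B :=
      Finset.single_le_sum (f := fun m => 2 * (f m).totalDegree) (fun _ _ => Nat.zero_le _)
        (Finset.mem_range.2 (not_le.1 hn))
    exact mono _ _ (le_trans (by omega) hwidth) (mem_diNarrowSpan_twice_degree (f n) (hsymm n))

/-! ### R1 ⟹ `LvDiNarrowSpan` -/

/-- **The linear-volume class is square-symmetric** (in `rename` form; cf.
`OrbitRestorationLinearVolumeQPDiNarrow.rename_diag_lvExpansion`). [folklore] -/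
theorem rename_diag_lvExpansion' {n m : ℕ} (a b : Fin m → ℕ)
    (E : (i : Fin m) → Multiset (Fin (a i) × Fin (b i))) (α : Fin m → ℂ) (σ : Equiv.Perm (Fin n)) :
    rename (fun ij : Fin n × Fin n => (σ ij.1, σ ij.2)) (∑ i : Fin m, C (α i) * homPoly (E i) n ℂ) =
      ∑ i : Fin m, C (α i) * homPoly (E i) n ℂ := by
  rw [map_sum]
  refine Finset.sum_congr rfl fun i _ => ?_
  rw [map_mul, rename_C, rename_perm_homPoly]

/-- **R1 ⟹ `LvDiNarrowSpan`.**  If `OrbitRestorationLinearVolumeQP` holds, every `VP` family of the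
linear-volume class lies, for one constant `c` and EVERY level `n`, in the `ℂ`-span of the one-sorted
homomorphism polynomials `dihom_{D,n}` of directed looped patterns of treewidth `≤ (log₂ n + c)^c`.
[cite: DawarPagoSeppelt2025, Thm 1.1 and §7 p. 45; DwivediPagoSeppelt2026, Outlook Q3] -/
theorem lvDiNarrowSpan_of_orbitRestorationLinearVolumeQP
    (h : Summit.ValiantsHypothesis.ValiantsHypothesis.Theses.MonotoneRestoration.OrbitRestorationLinearVolumeQP)
    (f : (n : ℕ) → MvPolynomial (Fin n × Fin n) ℂ) (hVP : IsVPFamily f)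
    (hLV : ∃ (c : ℕ) (m : ℕ → ℕ) (a b : (n : ℕ) → Fin (m n) → ℕ)
        (E : (n : ℕ) → (i : Fin (m n)) → Multiset (Fin (a n i) × Fin (b n i)))
        (α : (n : ℕ) → Fin (m n) → ℂ),
      (∀ n, m n ≤ (n + 2) ^ c) ∧ (∀ n i, a n i + b n i ≤ c * (n + 1)) ∧
        ∀ n, f n = ∑ i : Fin (m n), C (α n i) * homPoly (E n i) n ℂ) :
    ∃ c : ℕ, ∀ n : ℕ, f n ∈ Submodule.span ℂ {q : MvPolynomial (Fin n × Fin n) ℂ |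
      ∃ (a : ℕ) (D : Multiset (Fin a × Fin a)),
        treewidth (SimpleGraph.fromRel fun u v : Fin a => ∃ e ∈ D, u = e.1 ∧ v = e.2) ≤ (Nat.log 2 n + c) ^ c ∧
          q = diHomPoly D n ℂ} := by
  refine diNarrowSpan_of_diNarrow f (fun n σ => ?_)
    (OrbitRestorationLinearVolumeQPDiNarrow.lvDiNarrow_of_orbitRestorationLinearVolumeQP h f hVP hLV)
  obtain ⟨c, m, a, b, E, α, -, -, hf⟩ := hLV
  rw [hf n]
  exact rename_diag_lvExpansion' (a n) (b n) (E n) (α n) σ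

/-! ### `LvDiNarrowSpan` ⟹ R1 -/

/-- Label budget: `n^(W + 1) ≤ 2^((log₂ n + c + 3)^(c + 3))` for `W = (log₂ n + c)^c`. [folklore] -/
theorem pow_polylog_succ_le_qp (n c : ℕ) :
    n ^ ((Nat.log 2 n + c) ^ c + 1) ≤ 2 ^ ((Nat.log 2 n + (c + 3)) ^ (c + 3)) := by
  refine le_trans ?_ (narrowExpansion_orbit_bound n c)
  calc n ^ ((Nat.log 2 n + c) ^ c + 1) ≤ (n + 1) ^ ((Nat.log 2 n + c) ^ c + 1) :=
        Nat.pow_le_pow_left (Nat.le_succ n) _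
    _ ≤ (n + 1) ^ ((Nat.log 2 n + c) ^ c + 1 + ((Nat.log 2 n + c) ^ c + 1) + 2) :=
        Nat.pow_le_pow_right (Nat.succ_pos n) (by omega)

/-- **`LvDiNarrowSpan` ⟹ R1.**  If every `VP` family of the linear-volume class lies, for one constant and every
level, in the span of the one-sorted homomorphism polynomials of patterns of treewidth `≤ (log₂ n + c)^c`, then
`OrbitRestorationLinearVolumeQP` holds: from level `1` on the span is ONE closed one-sorted expression with
`(log₂ n + c)^c + 1` labels (one-sorted K2, `DiHomPolyClose.diNarrowExpression_of_mem_diNarrowSpan`),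
`n^{(log₂ n + c)^c + 1} ≤ 2^{(log₂ n + c + 3)^{c+3}}`, and the crux follows from one-sorted expression-narrowness
(`OrbitRestorationLinearVolumeQPDiNarrow.orbitRestorationLinearVolumeQP_of_lvDiNarrow`).
[cite: DawarPagoSeppelt2025, Thm 1.1 and §7 p. 45; DwivediPagoSeppelt2026, Outlook Q3] -/
theorem orbitRestorationLinearVolumeQP_of_lvDiNarrowSpan
    (h : ∀ f : (n : ℕ) → MvPolynomial (Fin n × Fin n) ℂ, IsVPFamily f →
      (∃ (c : ℕ) (m : ℕ → ℕ) (a b : (n : ℕ) → Fin (m n) → ℕ)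
          (E : (n : ℕ) → (i : Fin (m n)) → Multiset (Fin (a n i) × Fin (b n i)))
          (α : (n : ℕ) → Fin (m n) → ℂ),
        (∀ n, m n ≤ (n + 2) ^ c) ∧ (∀ n i, a n i + b n i ≤ c * (n + 1)) ∧
          ∀ n, f n = ∑ i : Fin (m n), C (α n i) * homPoly (E n i) n ℂ) →
      ∃ c : ℕ, ∀ n : ℕ, f n ∈ Submodule.span ℂ {q : MvPolynomial (Fin n × Fin n) ℂ |
        ∃ (a : ℕ) (D : Multiset (Fin a × Fin a)),
          treewidth (SimpleGraph.fromRel fun u v : Fin a => ∃ e ∈ D, u = e.1 ∧ v = e.2) ≤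
              (Nat.log 2 n + c) ^ c ∧
            q = diHomPoly D n ℂ}) :
    Summit.ValiantsHypothesis.ValiantsHypothesis.Theses.MonotoneRestoration.OrbitRestorationLinearVolumeQP := by
  refine OrbitRestorationLinearVolumeQPDiNarrow.orbitRestorationLinearVolumeQP_of_lvDiNarrow
    fun f hVP hLV => ?_
  obtain ⟨c, hc⟩ := h f hVP hLV
  refine ⟨c + 3, 1, fun n hn => ?_⟩
  obtain ⟨e, he⟩ := DiHomPolyClose.diNarrowExpression_of_mem_diNarrowSpan hn _ (f n) (hc n)
  exact ⟨(Nat.log 2 n + c) ^ c + 1, e, pow_polylog_succ_le_qp n c, he⟩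

/-- **THE CRUX IN ONE-SORTED SPAN CURRENCY (tight).**  `OrbitRestorationLinearVolumeQP` holds if and only if
every `VP` family of the linear-volume class (level by level a combination of `≤ (n+2)^c` homomorphism
polynomials of bipartite patterns with `≤ c (n+1)` vertices) lies, for one constant `c'` and EVERY level `n`, in
the `ℂ`-span of the one-sorted homomorphism polynomials `dihom_{D,n}` of directed looped multigraph patterns `D` of
treewidth `≤ (log₂ n + c')^{c'}` — the statement `LvDiNarrowSpan`, of the same shape as the registered stub
`LvNarrowSpan` of line `birth` with one-sorted patterns in place of bipartite ones.  A skeleton with this single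
stub closes R1 with NO loss. [cite: DawarPagoSeppelt2025, Thm 1.1 and §7 p. 45; DwivediPagoSeppelt2026, Outlook Q3] -/
theorem orbitRestorationLinearVolumeQP_iff_lvDiNarrowSpan :
    Summit.ValiantsHypothesis.ValiantsHypothesis.Theses.MonotoneRestoration.OrbitRestorationLinearVolumeQP ↔
    ∀ f : (n : ℕ) → MvPolynomial (Fin n × Fin n) ℂ, IsVPFamily f →
      (∃ (c : ℕ) (m : ℕ → ℕ) (a b : (n : ℕ) → Fin (m n) → ℕ)
          (E : (n : ℕ) → (i : Fin (m n)) → Multiset (Fin (a n i) × Fin (b n i)))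
          (α : (n : ℕ) → Fin (m n) → ℂ),
        (∀ n, m n ≤ (n + 2) ^ c) ∧ (∀ n i, a n i + b n i ≤ c * (n + 1)) ∧
          ∀ n, f n = ∑ i : Fin (m n), C (α n i) * homPoly (E n i) n ℂ) →
      ∃ c : ℕ, ∀ n : ℕ, f n ∈ Submodule.span ℂ {q : MvPolynomial (Fin n × Fin n) ℂ |
        ∃ (a : ℕ) (D : Multiset (Fin a × Fin a)),
          treewidth (SimpleGraph.fromRel fun u v : Fin a => ∃ e ∈ D, u = e.1 ∧ v = e.2) ≤
              (Nat.log 2 n + c) ^ c ∧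
            q = diHomPoly D n ℂ} :=
  ⟨fun h f hVP hLV => lvDiNarrowSpan_of_orbitRestorationLinearVolumeQP h f hVP hLV,
    orbitRestorationLinearVolumeQP_of_lvDiNarrowSpan⟩

/-! ### Position relative to the registered stub -/

/-- **The registered stub's conclusion implies the tight one** (orientation of bipartite patterns,
`SubThresholdDescent.narrowSpan_le_diNarrowSpan`), level by level and family by family. [folklore] -/
theorem diNarrowSpan_of_narrowSpan {n w : ℕ} (p : MvPolynomial (Fin n × Fin n) ℂ)
    (hp : p ∈ Submodule.span ℂ {q : MvPolynomial (Fin n × Fin n) ℂ | ∃ (a b : ℕ) (F : Multiset (Fin a × Fin b)),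
      treewidth (SimpleGraph.fromRel fun u v : Fin a ⊕ Fin b =>
          ∃ e ∈ F, u = Sum.inl e.1 ∧ v = Sum.inr e.2) ≤ w ∧
        q = homPoly F n ℂ}) :
    p ∈ Submodule.span ℂ {q : MvPolynomial (Fin n × Fin n) ℂ |
      ∃ (a : ℕ) (D : Multiset (Fin a × Fin a)),
        treewidth (SimpleGraph.fromRel fun u v : Fin a => ∃ e ∈ D, u = e.1 ∧ v = e.2) ≤ w ∧
          q = diHomPoly D n ℂ} :=
  SubThresholdDescent.narrowSpan_le_diNarrowSpan n w hp

/-- **The tight statement implies the registered stub's conclusion below the injective threshold**: on a level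
with `2 · deg p ≤ n`, a MATRIX-symmetric `p` in the one-sorted narrow span of width `w` lies in the bipartite
narrow span of the same width (`SubThresholdDescent.subThreshold_descent`, p827466).  So `LvDiNarrowSpan` and
`LvNarrowSpan` differ at most on the levels with `deg f_n > n/2`. [folklore] -/
theorem narrowSpan_of_diNarrowSpan_halfDegree {n w : ℕ} (p : MvPolynomial (Fin n × Fin n) ℂ)
    (hp : ∀ σ τ : Equiv.Perm (Fin n), rename (fun ij : Fin n × Fin n => (σ ij.1, τ ij.2)) p = p)
    (hdeg : 2 * p.totalDegree ≤ n)
    (hmem : p ∈ Submodule.span ℂ {q : MvPolynomial (Fin n × Fin n) ℂ |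
      ∃ (a : ℕ) (D : Multiset (Fin a × Fin a)),
        treewidth (SimpleGraph.fromRel fun u v : Fin a => ∃ e ∈ D, u = e.1 ∧ v = e.2) ≤ w ∧
          q = diHomPoly D n ℂ}) :
    p ∈ Submodule.span ℂ {q : MvPolynomial (Fin n × Fin n) ℂ | ∃ (a b : ℕ) (F : Multiset (Fin a × Fin b)),
      treewidth (SimpleGraph.fromRel fun u v : Fin a ⊕ Fin b =>
          ∃ e ∈ F, u = Sum.inl e.1 ∧ v = Sum.inr e.2) ≤ w ∧
        q = homPoly F n ℂ} :=
  SubThresholdDescent.subThreshold_descent n w p hp hdeg hmem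

end Summit.ValiantsHypothesis.ValiantsHypothesis.Theorems.OrbitRestorationLinearVolumeQPDiNarrowSpan

end
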